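import Mathlib
import HarnessLib
import Summits.ValiantsHypothesis.ValiantsHypothesis.Theses.SchenstedIndex
import Summits.ValiantsHypothesis.ValiantsHypothesis.Theorems.SchenstedIndexBalancedSeparatingPolynomial
import Summits.ValiantsHypothesis.ValiantsHypothesis.Theorems.SchenstedIndexPartitionFunctional
import Summits.ValiantsHypothesis.ValiantsHypothesis.Theorems.SchenstedIndexBlockPartitionOfLabelCount
import Summits.ValiantsHypothesis.ValiantsHypothesis.Theorems.SchenstedIndexSlotPencilSpan
import Summits.ValiantsHypothesis.ValiantsHypothesis.Theorems.SchenstedIndexCountVectors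

/-!
# Route SchenstedIndex — `BorderPcPerThree` (stmt-ValiantsHypothesis-16085) PROVED AS TYPED

`Summit.ValiantsHypothesis.ValiantsHypothesis.Theses.SchenstedIndex.BorderPcPerThree`: for some `t` the
1-factorisation indicator `1_OF(t,3)` of the 3-block partitions of the slot set `Fin t × Fin 3 × Fin 3` is
NOT in the span `span_3(t,3)` of the block-cycle vectors of slot matrices of rank `≤ 3` — i.e. the
route's certificate for "border power-trace complexity of `per_3` is `≥ 4`" EXISTS (completeness of the
certificate scheme at `m = n = 3`).

PROOF (completeness transfer, assembling the day's files):
(a)+(b) `exists_balanced_separating_polynomial_perPoly_three` — from `per_3 ∉ Δ(tr X_3³)` (orbit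
dimensions `4 < 8`), a polynomial `q` on coefficient space, balanced of weight `t·J` in degree-3
coordinates, vanishing at every width-3 power trace `tr(A_M³)` and not at `per_3`;
(c) every monomial of such a `q` is the label-multiset monomial of a 3-block partition
(`exists_blockPartition_of_balanced`, from `exists_blockPartition_of_labelCount`);
(d) `exists_labelConsistent_functional` — a functional `a` on block partitions, invariant under
label-preserving slot permutations, with `∑_π a(π) E(f)(π) = c · q(f)`, `c ≠ 0`, where
`E(f)(π) = ∏_(B ∈ π) coeff_(1_B) θ(f)` is the block functional of the polarisation `θ`;
(e) `sum_blockCycleVec_eq_zero_of_labelConsistent` — since `a` kills the block-cycle sums of all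
label-consistent pencils (these are `E(tr A_M³) = c·q(tr A_M³) = 0`, `theta_tracePow_pencil`,
`prod_coeff_indicator_trace_pencil_pow_eq_sum`), it kills those of ALL slot pencils, whose span is
`span_3(t,3)` (`span_blockCoeffVec_slotPencil_eq_span_count`, `mem_span_rank_le_iff_mem_span_count`);
(f) but `∑_π a(π) 1_OF(π) = ∑_π a(π) E(per_3)(π) = c · q(per_3) ≠ 0` (`coeff_indicator_theta_perPoly`).

HONEST FRAMING: a calibration rung (support item) of the OPEN route SchenstedIndex; the lower bound it
certifies (`pc̲(per_3) ≥ 4`) is tiny and classical in spirit; nothing here bears on `VP ≠ VNP`.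
-/

set_option linter.dupNamespace false

noncomputable section

namespace Summit.ValiantsHypothesis.ValiantsHypothesis.Theorems.SchenstedIndex

open MvPolynomial
open Literature.Computability.AlgebraicComplexity

/-! ## (c) monomials of a balanced polynomial are partition monomials -/

/-- A multiset, summed as unit finsupps, is its multiplicity function. -/
theorem sum_map_single_eq_toFinsupp {α : Type*} [DecidableEq α] (M : Multiset α) :
    (M.map fun a => Finsupp.single a 1).sum = Multiset.toFinsupp M := by
  induction M using Multiset.induction_on with
  | empty => simp
  | cons a M ih =>
      rw [Multiset.map_cons, Multiset.sum_cons, ih, ← Multiset.singleton_add, map_add,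
        Multiset.toFinsupp_singleton]

/-- **Step (c)**: an exponent `e` on coefficient space all of whose coordinates have degree `m` and whose
torus weight is `t · J` is the label-multiset exponent `∑_(B ∈ π) [α_B]` of some `m`-block partition `π`
of the slots `Fin t × Fin m × Fin m` (enumerate `e` as a list and apply
`exists_blockPartition_of_labelCount`). -/
theorem exists_blockPartition_of_balanced {t m : ℕ} (hm : 0 < m)
    (e : ((Fin m × Fin m) →₀ ℕ) →₀ ℕ) (hdeg : ∀ d ∈ e.support, Finsupp.degree d = m)
    (hw : Finsupp.weight (fun d : (Fin m × Fin m) →₀ ℕ => d) e =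
      t • ∑ ℓ : Fin m × Fin m, Finsupp.single ℓ 1) :
    ∃ π : {π : Finpartition (Finset.univ : Finset (Fin t × Fin m × Fin m)) //
        ∀ B ∈ π.parts, B.card = m},
      (∑ B ∈ π.1.parts, Finsupp.single (∑ s ∈ B, Finsupp.single s.2 1) 1 :
        ((Fin m × Fin m) →₀ ℕ) →₀ ℕ) = e := by
  classical
  -- total degree `deg e = t * m`
  have hdeg_e : Finsupp.degree e = t * m := by
    have h := congrArg Finsupp.degree hw
    rw [Finsupp.weight_apply, Finsupp.sum] at h
    simp only [map_sum, map_nsmul, Finsupp.degree_single, smul_eq_mul, mul_one,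
      Finset.sum_const, Finset.card_univ, Fintype.card_prod, Fintype.card_fin] at h
    rw [Finset.sum_congr rfl (fun a ha => by rw [hdeg a ha]), ← Finset.sum_mul] at h
    have h' : Finsupp.degree e * m = t * m * m := by rw [Finsupp.degree_apply, h]; ring
    exact Nat.eq_of_mul_eq_mul_right hm h'
  -- enumerate `e` as a list
  set l : List ((Fin m × Fin m) →₀ ℕ) := (Finsupp.toMultiset e).toList with hl
  have hlen : l.length = t * m := by
    rw [hl, Multiset.length_toList, Finsupp.card_toMultiset, ← hdeg_e, Finsupp.degree_apply]
    rfl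
  have hmem : ∀ i : Fin l.length, l.get i ∈ e.support := fun i =>
    (Finsupp.mem_toMultiset _ _).mp (Multiset.mem_toList.mp (List.get_mem l i))
  have hsum : (∑ i : Fin l.length, Finsupp.single (l.get i) 1 : ((Fin m × Fin m) →₀ ℕ) →₀ ℕ) = e := by
    rw [← List.sum_ofFn]
    change (List.ofFn ((fun a => (Finsupp.single a 1 : ((Fin m × Fin m) →₀ ℕ) →₀ ℕ)) ∘ l.get)).sum = e
    rw [← List.map_ofFn, List.ofFn_get, ← Multiset.sum_coe, ← Multiset.map_coe, hl,
      Multiset.coe_toList, sum_map_single_eq_toFinsupp, Finsupp.toMultiset_toFinsupp]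
  -- the data for `exists_blockPartition_of_labelCount`
  set d : Fin (t * m) → ((Fin m × Fin m) →₀ ℕ) := fun j => l.get (Fin.cast hlen.symm j) with hd
  have hsum' : (∑ j, Finsupp.single (d j) 1 : ((Fin m × Fin m) →₀ ℕ) →₀ ℕ) = e := by
    rw [← hsum]
    exact Equiv.sum_comp (finCongr hlen.symm)
      (fun i : Fin l.length => (Finsupp.single (l.get i) 1 : ((Fin m × Fin m) →₀ ℕ) →₀ ℕ))
  have hdeg' : ∀ j, (d j).sum (fun _ n => n) = m := by
    intro j
    have h := hdeg _ (hmem (Fin.cast hlen.symm j))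
    rw [Finsupp.degree_apply] at h
    exact h
  have hcount' : ∑ j, d j = t • ∑ ℓ : Fin m × Fin m, Finsupp.single ℓ 1 := by
    calc ∑ j, d j = ∑ j, Finsupp.weight (fun d : (Fin m × Fin m) →₀ ℕ => d)
          (Finsupp.single (d j) 1) := by simp [Finsupp.weight_single]
      _ = Finsupp.weight (fun d : (Fin m × Fin m) →₀ ℕ => d) (∑ j, Finsupp.single (d j) 1) := by
          rw [map_sum]
      _ = t • ∑ ℓ : Fin m × Fin m, Finsupp.single ℓ 1 := by rw [hsum', hw]
  obtain ⟨π, β, hβ⟩ := exists_blockPartition_of_labelCount (t := t) hm d hdeg' hcount'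
  refine ⟨π, ?_⟩
  rw [← hsum', ← Finset.sum_coe_sort π.1.parts, ← Equiv.sum_comp β]
  exact Finset.sum_congr rfl fun j _ => by rw [hβ j]

/-! ## Polarised label pencils -/

/-- `θ(tr A_M^k) = tr(Ñ^k)` for the label-consistent slot pencil `Ñ = ∑_s y_s M_(s.2)`. -/
theorem theta_tracePow_pencil {t n : ℕ} {L : Type*} [Fintype L] [DecidableEq L] (k : ℕ)
    (M : L → Matrix (Fin n) (Fin n) ℂ) :
    aeval (fun ℓ : L => ∑ j : Fin t, (X (j, ℓ) : MvPolynomial (Fin t × L) ℂ))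
        (((Matrix.of fun a b : Fin n => ∑ ℓ : L,
          C (M ℓ a b) * (X ℓ : MvPolynomial L ℂ)) ^ k).trace) =
      ((Matrix.of fun a b : Fin n => ∑ s : Fin t × L,
        C (M s.2 a b) * (X s : MvPolynomial (Fin t × L) ℂ)) ^ k).trace := by
  set θ : MvPolynomial L ℂ →ₐ[ℂ] MvPolynomial (Fin t × L) ℂ :=
    aeval (fun ℓ : L => ∑ j : Fin t, (X (j, ℓ) : MvPolynomial (Fin t × L) ℂ)) with hθ
  rw [AddMonoidHom.map_trace θ, ← AlgHom.mapMatrix_apply, map_pow, AlgHom.mapMatrix_apply]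
  congr 2
  refine Matrix.ext fun a b => ?_
  simp only [Matrix.map_apply, Matrix.of_apply, map_sum, map_mul, hθ, aeval_C, aeval_X,
    algebraMap_eq, Finset.mul_sum]
  rw [Finset.sum_comm, Fintype.sum_prod_type]

/-! ## The crux -/

/-- **`BorderPcPerThree` (stmt-ValiantsHypothesis-16085) holds**: for some `t`, the 1-factorisation
indicator `1_OF(t,3)` is not in `span_3(t,3)`. -/
theorem borderPcPerThree_proof :
    Summit.ValiantsHypothesis.ValiantsHypothesis.Theses.SchenstedIndex.BorderPcPerThree := by
  classical
  obtain ⟨t, q, hsupp, hvan, hper⟩ := exists_balanced_separating_polynomial_perPoly_three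
  have hq : ∀ e ∈ q.support, ∃ π : {π : Finpartition (Finset.univ : Finset (Fin t × Fin 3 × Fin 3)) //
      ∀ B ∈ π.parts, B.card = 3},
      (∑ B ∈ π.1.parts, Finsupp.single (∑ s ∈ B, Finsupp.single s.2 1) 1 :
        ((Fin 3 × Fin 3) →₀ ℕ) →₀ ℕ) = e :=
    fun e he => exists_blockPartition_of_balanced (by norm_num) e (hsupp e he).1 (hsupp e he).2
  obtain ⟨a, ha, c, hc, hpair⟩ := exists_labelConsistent_functional (t := t) (m := 3) q hq
  refine ⟨t, ?_⟩
  rw [mem_span_rank_le_iff_mem_span_count,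
    ← span_blockCoeffVec_slotPencil_eq_span_count (t := t) (m := 3) (n := 3) (by norm_num)]
  intro hmem
  -- the functional `Λ v = ∑_π a π · v π`
  set Λ : ({π : Finpartition (Finset.univ : Finset (Fin t × Fin 3 × Fin 3)) //
      ∀ B ∈ π.parts, B.card = 3} → ℂ) →ₗ[ℂ] ℂ := ∑ π, a π • LinearMap.proj π with hΛ
  have hΛapply : ∀ v, Λ v = ∑ π, a π * v π := by
    intro v
    simp only [hΛ, LinearMap.coe_sum, Finset.sum_apply, LinearMap.smul_apply,
      LinearMap.coe_proj, Function.eval, smul_eq_mul]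
  -- (e) `a` kills the block-cycle sums of every label-consistent pencil, hence of every slot pencil
  have hvanM : ∀ M : Fin 3 × Fin 3 → Matrix (Fin 3) (Fin 3) ℂ,
      ∑ π : {π : Finpartition (Finset.univ : Finset (Fin t × Fin 3 × Fin 3)) //
          ∀ B ∈ π.parts, B.card = 3},
        a π * ∑ ρ : Fin t × Fin 3 × Fin 3 → Fin 3, ∏ B ∈ π.1.parts, ∑ q : Fin 3 ≃ ↥B,
          ∏ i : Fin 3, M (q i).1.2 (ρ (q i).1) (ρ (q (finRotate 3 i)).1) = 0 := by
    intro M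
    have h := hpair (((Matrix.of fun a b : Fin 3 => ∑ ℓ : Fin 3 × Fin 3,
      C (M ℓ a b) * (X ℓ : MvPolynomial (Fin 3 × Fin 3) ℂ)) ^ 3).trace)
    rw [hvan M, mul_zero] at h
    rw [← h]
    refine Finset.sum_congr rfl fun π _ => ?_
    congr 1
    rw [theta_tracePow_pencil 3 M,
      prod_coeff_indicator_trace_pencil_pow_eq_sum (by norm_num : 0 < 3) (fun s => M s.2) π]
    rfl
  have hker : ∀ N : Fin t × Fin 3 × Fin 3 → Matrix (Fin 3) (Fin 3) ℂ,
      Λ (fun π => ∏ B ∈ π.1.parts, coeff (∑ s ∈ B, Finsupp.single s 1)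
        ((Matrix.of fun a b : Fin 3 => ∑ s : Fin t × Fin 3 × Fin 3,
          C (N s a b) * (X s : MvPolynomial (Fin t × Fin 3 × Fin 3) ℂ)) ^ 3).trace) = 0 := by
    intro N
    rw [hΛapply, ← sum_blockCycleVec_eq_zero_of_labelConsistent a ha hvanM N]
    refine Finset.sum_congr rfl fun π _ => ?_
    rw [prod_coeff_indicator_trace_pencil_pow_eq_sum (by norm_num : 0 < 3) N π]
    rfl
  have hle : Submodule.span ℂ (Set.range fun N : Fin t × Fin 3 × Fin 3 → Matrix (Fin 3) (Fin 3) ℂ =>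
      fun π : {π : Finpartition (Finset.univ : Finset (Fin t × Fin 3 × Fin 3)) //
          ∀ B ∈ π.parts, B.card = 3} =>
        ∏ B ∈ π.1.parts, coeff (∑ s ∈ B, Finsupp.single s 1)
          ((Matrix.of fun a b : Fin 3 => ∑ s : Fin t × Fin 3 × Fin 3,
            C (N s a b) * (X s : MvPolynomial (Fin t × Fin 3 × Fin 3) ℂ)) ^ 3).trace) ≤
      LinearMap.ker Λ := by
    rw [Submodule.span_le]
    rintro _ ⟨N, rfl⟩
    exact LinearMap.mem_ker.mpr (hker N)
  have h0 := LinearMap.mem_ker.mp (hle hmem)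
  -- (f) but `Λ(1_OF) = c · q(per_3) ≠ 0`
  rw [hΛapply] at h0
  have hE : ∀ (π : {π : Finpartition (Finset.univ : Finset (Fin t × Fin 3 × Fin 3)) //
      ∀ B ∈ π.parts, B.card = 3})
      [Decidable (∀ B ∈ π.1.parts,
        (B.image fun s => s.2.1).card = 3 ∧ (B.image fun s => s.2.2).card = 3)],
      (if ∀ B ∈ π.1.parts, (B.image fun s => s.2.1).card = 3 ∧ (B.image fun s => s.2.2).card = 3
        then (1 : ℂ) else 0) =
      ∏ B ∈ π.1.parts, coeff (∑ s ∈ B, Finsupp.single s 1)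
        (aeval (fun ℓ : Fin 3 × Fin 3 => ∑ k : Fin t,
          (X (k, ℓ) : MvPolynomial (Fin t × Fin 3 × Fin 3) ℂ)) (perPoly (Fin 3) ℂ)) := by
    intro π _
    rw [Finset.prod_congr rfl (fun B hB => coeff_indicator_theta_perPoly B (π.2 B hB)),
      Finset.prod_boole]
    by_cases h : ∀ B ∈ π.1.parts, (B.image fun s => s.2.1).card = 3 ∧
        (B.image fun s => s.2.2).card = 3
    · rw [if_pos h, if_pos h]
    · rw [if_neg h, if_neg h]
  rw [Finset.sum_congr rfl (fun π _ => by rw [hE π]), hpair (perPoly (Fin 3) ℂ)] at h0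
  exact (mul_ne_zero hc hper) h0

end Summit.ValiantsHypothesis.ValiantsHypothesis.Theorems.SchenstedIndex

end
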